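import Summits.QuantumFields.BalabanUV.T4Continuum.Support.NE7OneStepCornerForm
import Summits.QuantumFields.BalabanUV.T4Continuum.Support.NE3QuadRemainderSup
import Summits.QuantumFields.BalabanUV.T4Continuum.Support.NE3CpushGaugeCovariance
import Summits.QuantumFields.BalabanUV.T4Continuum.Support.NE3FramePotBoundW
import HarnessLib

/-!
# NE7RelIterCornerForm — THE k-FOLD NONLINEAR AVERAGE IN CORNER FORM, AND THE UNSHIFTED-FIBRE FIXED POINT (memo ROAD-G102 §9 STEP 1, §10)

Cell `pub-balaban`, lineage `t4-ne7-p1` (CRUX PROVER NE7 #1, owner of BINDER row NE7), gen 102; sequel of `NE7OneStepCornerForm` (one step).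
B7's covariance of the ITERATED average (`NE3CpushGaugeCovariance.cavgIter_gaugeAct`: `cavgIter(W^{u}) = (cavgIter W)^{u∘L^K}`), the bondwise
extraction `W·e^{gaugeDir Λ + R} = (W·e^{R′})^{e^{Λ}}`, `R′ = gaugeExtract W Λ R` (`BlockAverageGaugeExtractCfg.vary_gaugeDir_add_eq_gaugeAct`) and the
consistency of the relative coordinate at every level (`NE3QuadRemainderSup.cavgIter_vary_eq_vary_relIter_of_tower`) give the EXACT k-fold three-factor form
  `relIter L K W (gaugeDir W Λ + R) (z,κ) = log( e^{Ad_{V(z,κ)⁻¹}Λ(L^K•z)} · e^{relIter L K W R′ (z,κ)} · e^{−Λ(L^K•(z+e_κ))} )`, `V = cavgIter L K W`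
(`relIter_gaugeDir_add`), for ANY fine skew gauge field `Λ` below `1∕64` — only its values at the images `L^K•z` of the coarse corners appear in the
corner factors.  Consequences: the CORNER FORM `‖relIter X − log(e^{Ad Λ_K}e^{−Λ_K′})‖ ≤ 3‖relIter R′‖` (`norm_relIter_gaugeDir_add_sub_corner_le`, by
`NE7OneStepCornerForm.norm_mlog_exp3_sub_mlog_exp2_le`), and THE UNSHIFTED-FIBRE FIXED POINT: if the k-fold average of `W·e^{X}` is the coarse gauge
transform of `V` by `e^{Λ(L^K•)}` — the (S1) fibre of `NE7SliceTheorem` with `Λ(L^K•z) = h(z)` the corner logs — then the straight gauge copy has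
VANISHING relative coordinate, `relIter L K W R′ = 0` (`relIter_gaugeExtract_eq_zero_of_fibre`), i.e. its k-fold LINEARISED average equals minus its own
quadratic remainder, `dirIter L K W R′ = −(relIter − dirIter) L K W R′` (`dirIter_gaugeExtract_eq_neg_quadRem_of_fibre`): the corner-charge terms `R₂(h)` of
`NE7SliceCoarseDatumLetter` are removed EXACTLY by regauging, and (S2) becomes a statement about the quadratic remainder of ONE near-tangent field.
-/

set_option autoImplicit false

open scoped BigOperators Matrix.Norms.L2Operator
open NormedSpace Finset

namespace Summit.QuantumFields.BalabanUV.T4Continuum.NE7RelIterCornerForm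

open Literature.MathematicalPhysics.QuantumFieldTheory.Balaban1983to89
open B7Prop1Explicit B7Prop2Explicit MatrixLog
open T4AveragingDeficitWall (IsSkewDir IsUnitaryCfg SmallField vary Ad)
open T4AveragingDeficitWallBoundary (IsPeriodicCfg)
open AveragingDeficitPeriodicCounting (IsPeriodicDir)
open AveragingDeficitMultiLevelPrep (cavgIter LevelSmall cavgIter_unitary_small)
open AveragingDeficitTransport (norm_Ad_of_unitary Ad_mem_skewAdjoint)
open AveragingDeficitLocality (expUnit_Ad)
open AveragingDeficitPlaqDeriv (vary_isUnitaryCfg)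
open BlockAverageVaryDisc (rho0)
open BlockAveragePushDirGauge (gaugeDir expGauge isPeriodicDir_gaugeDir)
open BlockAverageGaugeExtract (gaugeExtract)
open BlockAverageGaugeExtractCfg (vary_gaugeDir_add_eq_gaugeAct isSkewDir_gaugeExtract isPeriodicDir_gaugeExtract)
open NE3EnergyVary (smallField_vary_linear)
open NE3LinearisedAverageSup (curvSum)
open NE3TangentCovariantTower (dirIter)
open NE3QuadRemainderTower (relIter)
open NE3QuadRemainderSup (norm_relIter_le cavgIter_vary_eq_vary_relIter_of_tower sigma_lines rho0_le_one)
open NE3FramePotBoundW (levelSmall_pred)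
open NE3QuadRemainderGaugeStep (expGauge_one_mem_unitaryUnits)
open NE3CpushGaugeCovariance (cavgIter_gaugeAct)
open NE7OneStepCornerForm (norm_mlog_exp3_sub_mlog_exp2_le)

noncomputable section

variable {d : ℕ} {n : Type*} [Fintype n] [DecidableEq n] [Nonempty n]

section Tower

variable {L N k : ℕ} [NeZero N] (hL : 2 ≤ L) {W : Site d → Fin d → (Matrix n n ℂ)ˣ} {x : ℝ} (hWu : IsUnitaryCfg W)
  (hWP : IsPeriodicCfg W ((L ^ (k + 1) * N : ℕ) : ℤ)) (hx : 0 ≤ x) (hsm : LevelSmall d L (k + 1) x) (hWx : SmallField W x)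
  (hA : curvSum d L (k + 1) x ≤ 2 / 3 * L)
  {Λ : Site d → Matrix n n ℂ} (hΛ : ∀ y, Λ y ∈ skewAdjoint (Matrix n n ℂ)) (hΛs : ∀ y, ‖Λ y‖ < 1 / 64)
  (hΛP : ∀ (y : Site d) (i : Fin d), Λ (y + ((L ^ (k + 1) * N : ℕ) : ℤ) • e i) = Λ y)
  {R : Site d → Fin d → Matrix n n ℂ} (hR : IsSkewDir R) (hRs : ∀ y μ, ‖R y μ‖ < 1 / 64) (hRP : IsPeriodicDir R ((L ^ (k + 1) * N : ℕ) : ℤ))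
  {s : ℝ} (hs : 0 ≤ s) (hX : ∀ (y : Site d) (μ : Fin d), ‖(gaugeDir W Λ + R) y μ‖ ≤ s)
  (hσ : 4 * (3 + 12 * (d : ℝ)) ^ 2 * (L : ℝ) ^ (k + 1) * s ≤ rho0 d L ^ 2)
  {r : ℝ} (hr : ∀ (y : Site d) (μ : Fin d), ‖gaugeExtract W Λ R y μ‖ ≤ r) (hr1 : r ≤ 1)
  (hσr : 4 * (3 + 12 * (d : ℝ)) ^ 2 * (L : ℝ) ^ (k + 1) * r ≤ rho0 d L ^ 2) (hsmU : LevelSmall d L k (x + 8 * r))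

include hL hWu hWP hx hsm hWx hA hΛ hΛs hΛP hR hRs hRP hs hX hσ hr hr1 hσr hsmU

/-- **THE k-FOLD RELATIVE COORDINATE OF A FIELD WITH A GAUGE COMPONENT, EXACTLY.**  For `L ≥ 2`, a unitary `L^{k+1}N`-periodic background `W` in the
tower class (`LevelSmall d L (k+1) x`, `curvSum ≤ 2L∕3`), a skew periodic gauge field `Λ` below `1∕64`, a skew periodic `R` below `1∕64`, the field
`X := gaugeDir W Λ + R` of sup `s` and the extracted field `R′ := gaugeExtract W Λ R` of sup `r ≤ 1` both on the σ-line `4(3+12d)²L^{k+1}·(·) ≤ ρ₀²`, and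
the enlarged class `LevelSmall d L k (x + 8r)` (so that `W·e^{R′}` is averaged covariantly): at every coarse bond,
`relIter L (k+1) W X (z,κ) = log( e^{Ad_{V(z,κ)⁻¹}Λ(L^{k+1}•z)} · e^{relIter L (k+1) W R′ (z,κ)} · e^{−Λ(L^{k+1}•(z+e_κ))} )`, `V = cavgIter L (k+1) W`.
[cite: Balaban1985Averaging, (45) p.24, (127) p.37] -/
theorem relIter_gaugeDir_add (z : Site d) (κ : Fin d) :
    relIter L (k + 1) W (gaugeDir W Λ + R) z κ
      = mlog (exp (Ad (cavgIter L (k + 1) W z κ)⁻¹ (Λ (((L : ℤ) ^ (k + 1)) • z))) * exp (relIter L (k + 1) W (gaugeExtract W Λ R) z κ)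
          * exp (-(Λ (((L : ℤ) ^ (k + 1)) • (z + e κ))))) := by
  have hL1 : 1 ≤ L := by omega
  have hr0 : 0 ≤ r := (norm_nonneg _).trans (hr z κ)
  -- class facts of `X` and `R′`
  have hXs : IsSkewDir (gaugeDir W Λ + R) := fun y μ =>
    (skewAdjoint (Matrix n n ℂ)).add_mem
      ((skewAdjoint (Matrix n n ℂ)).sub_mem (Ad_mem_skewAdjoint ((unitaryUnits (Matrix n n ℂ)).inv_mem (hWu y μ)) (hΛ y)) (hΛ (y + e μ))) (hR y μ)
  have hXP : IsPeriodicDir (gaugeDir W Λ + R) ((L ^ (k + 1) * N : ℕ) : ℤ) := fun y i μ => by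
    simp only [Pi.add_apply]; rw [isPeriodicDir_gaugeDir hWP hΛP y i μ, hRP y i μ]
  have hR's : IsSkewDir (gaugeExtract W Λ R) := isSkewDir_gaugeExtract hWu hΛ hR hΛs hRs
  have hR'P : IsPeriodicDir (gaugeExtract W Λ R) ((L ^ (k + 1) * N : ℕ) : ℤ) := isPeriodicDir_gaugeExtract hWP hΛP hRP
  -- (1) extraction, (2) covariance of the iterated average, (3) consistency for `R′` and for `X`
  have h1 : vary W (gaugeDir W Λ + R) 1 = gaugeAct (expGauge Λ 1) (vary W (gaugeExtract W Λ R) 1) :=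
    vary_gaugeDir_add_eq_gaugeAct hWu Λ R hΛs hRs
  have hU : IsUnitaryCfg (vary W (gaugeExtract W Λ R) 1) := vary_isUnitaryCfg hWu hR's 1
  have hUx : SmallField (vary W (gaugeExtract W Λ R) 1) (x + 8 * r) := smallField_vary_linear hWu hWx hR's hr0 hr1 hr
  have hu : ∀ y, expGauge Λ 1 y ∈ unitaryUnits (Matrix n n ℂ) := expGauge_one_mem_unitaryUnits hΛ
  have h2 : cavgIter L (k + 1) (gaugeAct (expGauge Λ 1) (vary W (gaugeExtract W Λ R) 1))
      = gaugeAct (fun w => expGauge Λ 1 (((L : ℤ) ^ (k + 1)) • w)) (cavgIter L (k + 1) (vary W (gaugeExtract W Λ R) 1)) :=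
    cavgIter_gaugeAct hL1 k hU (by positivity) hsmU hUx hu
  have h3 : cavgIter L (k + 1) (vary W (gaugeExtract W Λ R) 1) = vary (cavgIter L (k + 1) W) (relIter L (k + 1) W (gaugeExtract W Λ R)) 1 :=
    cavgIter_vary_eq_vary_relIter_of_tower hL hWu hWP hx hsm hWx hA hR's hR'P hr0 hr hσr (k := k + 1) le_rfl
  have h4 : cavgIter L (k + 1) (vary W (gaugeDir W Λ + R) 1) = vary (cavgIter L (k + 1) W) (relIter L (k + 1) W (gaugeDir W Λ + R)) 1 :=
    cavgIter_vary_eq_vary_relIter_of_tower hL hWu hWP hx hsm hWx hA hXs hXP hs hX hσ (k := k + 1) le_rfl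
  -- read both at the bond
  have hbX : cavgIter L (k + 1) (vary W (gaugeDir W Λ + R) 1) z κ
      = cavgIter L (k + 1) W z κ * expUnit (((1 : ℝ) : ℂ) • relIter L (k + 1) W (gaugeDir W Λ + R) z κ) := congrFun (congrFun h4 z) κ
  have hbR : cavgIter L (k + 1) (vary W (gaugeDir W Λ + R) 1) z κ
      = expGauge Λ 1 (((L : ℤ) ^ (k + 1)) • z)
          * (cavgIter L (k + 1) W z κ * expUnit (((1 : ℝ) : ℂ) • relIter L (k + 1) W (gaugeExtract W Λ R) z κ))
          * (expGauge Λ 1 (((L : ℤ) ^ (k + 1)) • (z + e κ)))⁻¹ := by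
    rw [h1, h2, h3]; rfl
  have hunit : expUnit (((1 : ℝ) : ℂ) • relIter L (k + 1) W (gaugeDir W Λ + R) z κ)
      = (cavgIter L (k + 1) W z κ)⁻¹ * expGauge Λ 1 (((L : ℤ) ^ (k + 1)) • z) * cavgIter L (k + 1) W z κ
          * expUnit (((1 : ℝ) : ℂ) • relIter L (k + 1) W (gaugeExtract W Λ R) z κ)
          * (expGauge Λ 1 (((L : ℤ) ^ (k + 1)) • (z + e κ)))⁻¹ := by
    have h := hbX.symm.trans hbR
    have h' := congrArg (fun t => (cavgIter L (k + 1) W z κ)⁻¹ * t) h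
    simp only [← mul_assoc, inv_mul_cancel, one_mul] at h'
    rw [h']
  have hval := congrArg Units.val hunit
  simp only [Units.val_mul, val_expUnit, expGauge, val_inv_expUnit, Complex.ofReal_one, one_smul] at hval
  -- `exp (Ad V⁻¹ Λ) = V⁻¹ e^{Λ} V`
  have hAd : exp (Ad (cavgIter L (k + 1) W z κ)⁻¹ (Λ (((L : ℤ) ^ (k + 1)) • z)))
      = (((cavgIter L (k + 1) W z κ)⁻¹ : (Matrix n n ℂ)ˣ) : Matrix n n ℂ) * exp (Λ (((L : ℤ) ^ (k + 1)) • z))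
          * ((cavgIter L (k + 1) W z κ : (Matrix n n ℂ)ˣ) : Matrix n n ℂ) := by
    have h := congrArg Units.val (expUnit_Ad (cavgIter L (k + 1) W z κ)⁻¹ (Λ (((L : ℤ) ^ (k + 1)) • z)))
    simpa only [val_expUnit, Units.val_mul, inv_inv] using h
  -- `log ∘ exp = id` on the small relative coordinate
  have hsmall : ‖relIter L (k + 1) W (gaugeDir W Λ + R) z κ‖ < Real.log 2 := by
    have e1 := norm_relIter_le hL hWu hWP hx hsm hWx hA hXs hXP hs hX hσ (k := k + 1) le_rfl z κ
    have e2 := (sigma_lines (d := d) hL hs hσ (i := k + 1) le_rfl).1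
    have e3 := rho0_le_one (d := d) (L := L) (by omega)
    linarith [Real.log_two_gt_d9]
  rw [← B7BlockAvgLog.mlog_exp hsmall, hval, hAd]

/-- **THE k-FOLD CORNER FORM**: in the same setting and with `‖relIter L (k+1) W R′ (z,κ)‖ ≤ 1∕32`,
`‖relIter L (k+1) W X (z,κ) − log( e^{Ad_{V⁻¹}Λ(L^{k+1}•z)} · e^{−Λ(L^{k+1}•(z+e_κ))} )‖ ≤ 3·‖relIter L (k+1) W R′ (z,κ)‖` — the k-fold nonlinear average of
`X = gaugeDir W Λ + R` IS the corner nonlinearity of the charges read at the coarse corners, up to a term linear in the relative coordinate of the straight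
gauge copy `R′`. [folklore] -/
theorem norm_relIter_gaugeDir_add_sub_corner_le (z : Site d) (κ : Fin d) (hρ : ‖relIter L (k + 1) W (gaugeExtract W Λ R) z κ‖ ≤ 1 / 32) :
    ‖relIter L (k + 1) W (gaugeDir W Λ + R) z κ
        - mlog (exp (Ad (cavgIter L (k + 1) W z κ)⁻¹ (Λ (((L : ℤ) ^ (k + 1)) • z))) * exp (-(Λ (((L : ℤ) ^ (k + 1)) • (z + e κ)))))‖
      ≤ 3 * ‖relIter L (k + 1) W (gaugeExtract W Λ R) z κ‖ := by
  rw [relIter_gaugeDir_add hL hWu hWP hx hsm hWx hA hΛ hΛs hΛP hR hRs hRP hs hX hσ hr hr1 hσr hsmU z κ]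
  have hL1 : 1 ≤ L := by omega
  have hV : cavgIter L (k + 1) W z κ ∈ unitaryUnits (Matrix n n ℂ) := (cavgIter_unitary_small hL1 k hWu hx (levelSmall_pred k hsm) hWx).1 z κ
  have hna : ‖Ad (cavgIter L (k + 1) W z κ)⁻¹ (Λ (((L : ℤ) ^ (k + 1)) • z))‖ = ‖Λ (((L : ℤ) ^ (k + 1)) • z)‖ :=
    norm_Ad_of_unitary ((unitaryUnits _).inv_mem hV) _
  exact norm_mlog_exp3_sub_mlog_exp2_le (by rw [hna]; exact (hΛs _).le) hρ (hΛs _).le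

omit hs hX hσ in
/-- **THE UNSHIFTED-FIBRE FIXED POINT.**  In the same setting: if the k-fold average of `W·e^{X}` is the COARSE GAUGE TRANSFORM of `V = cavgIter L (k+1) W` by
the corner values of `e^{Λ}` — `cavgIter L (k+1) (W·e^{X}) = V^{e^{Λ(L^{k+1}•)}}`, the (S1) fibre with `Λ(L^{k+1}•z) = h(z)` — then the straight gauge copy
`R′ = gaugeExtract W Λ R` has VANISHING k-fold relative coordinate: `relIter L (k+1) W R′ = 0` (its k-fold average is `V` itself; no class datum of `X` itself is
used). [folklore] -/
theorem relIter_gaugeExtract_eq_zero_of_fibre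
    (hfib : cavgIter L (k + 1) (vary W (gaugeDir W Λ + R) 1)
      = gaugeAct (fun w => expGauge Λ 1 (((L : ℤ) ^ (k + 1)) • w)) (cavgIter L (k + 1) W)) (z : Site d) (κ : Fin d) :
    relIter L (k + 1) W (gaugeExtract W Λ R) z κ = 0 := by
  have hL1 : 1 ≤ L := by omega
  have hr0 : 0 ≤ r := (norm_nonneg _).trans (hr z κ)
  have hR's : IsSkewDir (gaugeExtract W Λ R) := isSkewDir_gaugeExtract hWu hΛ hR hΛs hRs
  have hR'P : IsPeriodicDir (gaugeExtract W Λ R) ((L ^ (k + 1) * N : ℕ) : ℤ) := isPeriodicDir_gaugeExtract hWP hΛP hRP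
  have h1 : vary W (gaugeDir W Λ + R) 1 = gaugeAct (expGauge Λ 1) (vary W (gaugeExtract W Λ R) 1) :=
    vary_gaugeDir_add_eq_gaugeAct hWu Λ R hΛs hRs
  have hU : IsUnitaryCfg (vary W (gaugeExtract W Λ R) 1) := vary_isUnitaryCfg hWu hR's 1
  have hUx : SmallField (vary W (gaugeExtract W Λ R) 1) (x + 8 * r) := smallField_vary_linear hWu hWx hR's hr0 hr1 hr
  have hu : ∀ y, expGauge Λ 1 y ∈ unitaryUnits (Matrix n n ℂ) := expGauge_one_mem_unitaryUnits hΛ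
  have h2 : cavgIter L (k + 1) (gaugeAct (expGauge Λ 1) (vary W (gaugeExtract W Λ R) 1))
      = gaugeAct (fun w => expGauge Λ 1 (((L : ℤ) ^ (k + 1)) • w)) (cavgIter L (k + 1) (vary W (gaugeExtract W Λ R) 1)) :=
    cavgIter_gaugeAct hL1 k hU (by positivity) hsmU hUx hu
  have h3 : cavgIter L (k + 1) (vary W (gaugeExtract W Λ R) 1) = vary (cavgIter L (k + 1) W) (relIter L (k + 1) W (gaugeExtract W Λ R)) 1 :=
    cavgIter_vary_eq_vary_relIter_of_tower hL hWu hWP hx hsm hWx hA hR's hR'P hr0 hr hσr (k := k + 1) le_rfl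
  -- the two coarse gauge actions agree, hence the actee configurations agree bondwise
  have h := hfib
  rw [h1, h2, h3] at h
  have hb := congrFun (congrFun h z) κ
  simp only [gaugeAct, vary] at hb
  -- cancel the corner factors (the coarse configurations form a group)
  have hb' : cavgIter L (k + 1) W z κ * expUnit (((1 : ℝ) : ℂ) • relIter L (k + 1) W (gaugeExtract W Λ R) z κ) = cavgIter L (k + 1) W z κ * 1 := by
    rw [mul_one]; exact mul_left_cancel (mul_right_cancel hb)
  have hexp : expUnit (((1 : ℝ) : ℂ) • relIter L (k + 1) W (gaugeExtract W Λ R) z κ) = 1 := mul_left_cancel hb'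
  have hval : exp (relIter L (k + 1) W (gaugeExtract W Λ R) z κ) = 1 := by
    have := congrArg Units.val hexp
    simpa only [val_expUnit, Complex.ofReal_one, one_smul, Units.val_one] using this
  have hsmall : ‖relIter L (k + 1) W (gaugeExtract W Λ R) z κ‖ < Real.log 2 := by
    have e1 := norm_relIter_le hL hWu hWP hx hsm hWx hA hR's hR'P hr0 hr hσr (k := k + 1) le_rfl z κ
    have e2 := (sigma_lines (d := d) hL hr0 hσr (i := k + 1) le_rfl).1
    have e3 := rho0_le_one (d := d) (L := L) (by omega)
    linarith [Real.log_two_gt_d9]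
  rw [← B7BlockAvgLog.mlog_exp hsmall, hval, mlog_one]

omit hs hX hσ in
/-- **THE FIXED-POINT EQUATION OF THE STRAIGHT GAUGE COPY**: on the fibre of the previous theorem, the k-fold LINEARISED average of `R′` equals minus its own
quadratic remainder, `dirIter L (k+1) W R′ (z,κ) = −(relIter L (k+1) W R′ (z,κ) − dirIter L (k+1) W R′ (z,κ))` — the form in which row NE3's quadratic-remainder
letters (`NE3QuadRemainderSup`∕`Local`: `‖relIter − dirIter‖ ≤ (4(3+12d)³∕ρ₀²)(M·s_loc)²`) bear on (S2) with NO corner-charge term. [folklore] -/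
theorem dirIter_gaugeExtract_eq_neg_quadRem_of_fibre
    (hfib : cavgIter L (k + 1) (vary W (gaugeDir W Λ + R) 1)
      = gaugeAct (fun w => expGauge Λ 1 (((L : ℤ) ^ (k + 1)) • w)) (cavgIter L (k + 1) W)) (z : Site d) (κ : Fin d) :
    dirIter L (k + 1) W (gaugeExtract W Λ R) z κ
      = -(relIter L (k + 1) W (gaugeExtract W Λ R) z κ - dirIter L (k + 1) W (gaugeExtract W Λ R) z κ) := by
  rw [relIter_gaugeExtract_eq_zero_of_fibre hL hWu hWP hx hsm hWx hA hΛ hΛs hΛP hR hRs hRP hr hr1 hσr hsmU hfib z κ]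
  simp

end Tower

end

end Summit.QuantumFields.BalabanUV.T4Continuum.NE7RelIterCornerForm
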